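import Summits.QuantumFields.YangMills.Theorems.BalabanUVNodesN18HLayerW1TermWalkRecord

/-!
# BalabanUVNodes ∕ N18 — THE H-LAYER CHAIN FOR node00-def-W1's GENERATOR OF RECORD `𝔇.Gn` FROM NODE A's WALK RECORDS READ AT THE CONFIGURATION:
# (GEN), the (2.38) pair at every step, (1.18) for the generated tower, W1's `RecAdmissible` on print's table pair — files 23 ∕ 24's faces with BOTH
# per-term schema binders discharged by file 27 (Track A, DAG node N18 = NE5 `T4OutputRate.NE5 EA EB W κ θ C₅` :211; cluster K4 «SpineRates»; file 28 of
# seat pub-ymgap-dag-n18-c, row s1 «the H-layer activity datum on the record's torus catalogue», generation 6)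

Cell `pub-ymgap`, HUMAN RULING D-0062 (Track A), R134 ACCELERATION seat `pub-ymgap-dag-n18-c` (strategy s1), generation 6.  THEOREMS ONLY (no `def`, no
`instance`, no `sorry`); imports file 27 `…N18HLayerW1TermWalkRecord` (through it files 23–26, W1's STOREY 7, T25 ∕ T21, `B13TermWalkData`, Chae); restates
nothing.

WHY.  File 27 proved, for a (2.14) term-datum family `𝔇 : W1.TermData214 c⁺ (F.P K) 𝔸 M L` read through NODE A's walk records `TermWalkData ((𝔇 k).𝒦 Z t) w`
and the reading maps `uOf`, BOTH per-term schemas of file 23 along the history — (T-an) `termwiseAn_TF_of_termWalkData` and (T-226) (the `.2` half of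
`holAnd226_TF_of_termWalkData`) — and closed W1's `RecAdmissible` (`recAdmissible_Gn_of_termWalkData`).  The consumers of N18's configuration-direction
chain (dag-n18-d's Stage-12 ∕ 13 junctions, dag-n27-c's composite, dag-n22-*'s strip) read the OTHER faces of files 23 ∕ 24 BY NAME: the per-generator
schema (GEN) (`StepGen`-shape: activities analytic + (2.38)-bounded at every step), the (2.38) pair `AnalyticH ∧ Bound238` of `toClusterTower 𝔇.Gn k` on the
boxes `]0,γ]^{k+1}`, (1.18) `TermBound118` for the generated tower, and `RecAdmissible` on print's TABLE PAIR ([II] p. 15: older terms on `sp`, the step on the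
larger `sp′`).  THIS FILE serves those four faces in the walk-record currency — each ONE application of the file-23 ∕ 24 face with `hTan :=` file 27 §2 and
`hT226 :=` file 27 §2 — so that a junction keyed on (GEN) ∕ the (2.38) pair ∕ (1.18) is fed, by name, from: ONE admissible small walk package `w`, a walk
record and a holomorphic reading map per term, σ-holomorphy of the kernels (NODE O), symmetry ∕ `Re ≻ 0` (NODE A), LEMMA 2's potential letters along the
history, `χχᶜ` with (2.22), the record-letter numerics, and Lemma 3's numerics at `c`.

WHAT (theorems only; the section variables are file 27 §2's, verbatim).  `stepGen_Gn_of_termWalkData` ((GEN) for `𝔇.Gn`: file 23 `stepGen_ofTerms_of_termwise`),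
`hLayer_toClusterTower_Gn_of_termWalkData` (the (2.38) pair at every step on the boxes read inside `D`), `termBound118_toClusterTower_Gn_of_termWalkData`
((1.18) for `toClusterTower 𝔇.Gn` on every history set read inside `D`), `recAdmissible_Gn_of_termWalkData₂` (file 24's table pair: older terms on `sp`, the
step's (T-an) on `sp′ ⊆ big`, clause `Z ⊆ X ⇒ sp X ⊆ sp′ Z`).

HONEST FRAMING — what this is NOT.  Four one-line compositions of LANDED theorems; NO estimate of Bałaban's is proved here; every record, map, region and
number is a HYPOTHESIS; whether Bałaban's kernels of record admit walk records with one package is NODE O's (v) ∕ NODE A, not claimed.  Count-neutral; NOT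
a discharge of N18 (typed 28∕28 · discharged 5∕27 UNCHANGED); NE5 NOT IN PRINT ([I] Thm 1 p. 259) and NOT PROVED.  One finite four-torus programme at fixed
`ε`, Bałaban as printed — NOT ℝ⁴, NOT infinite volume, NOT OS, NOT a mass gap, NOT Clay.  0 `sorry`, 0 `def`.

References (TYPES ∕ loci only): [II] = [Balaban1988RG2Cluster] CMP **116** (1988) — (1.41) p. 11, p. 13, (2.14) p. 15 and the analyticity statement
p. 15, (2.16)–(2.26) pp. 16–17, Lemma 3 (2.38) p. 20, (2.41) p. 21, p. 22; [I] = [Balaban1987RG1] CMP **109** (1987) — (1.18) p. 263, Thm 1 p. 259;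
[B9] = [Balaban1985BackgroundPropagators] Thm 3.10 p. 416; [Chae1985] Thm 14.13.
-/

noncomputable section

open scoped Classical

namespace Summit.QuantumFields.YangMills.BalabanUVNodes.N18HLayerW1TermWalkRecordChain

open Set Metric
open scoped BigOperators Matrix Matrix.Norms.L2Operator
open Literature.MathematicalPhysics.QuantumFieldTheory.Balaban1983to89
open Literature.MathematicalPhysics.QuantumFieldTheory.Balaban1983to89.T4Continuum (T4Family)
open Literature.MathematicalPhysics.QuantumFieldTheory.Balaban1983to89.TreeLengthTorus (TDom TPt tsys)
open Literature.MathematicalPhysics.QuantumFieldTheory.Balaban1983to89.B12TreeDecay (K₀)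
open Literature.MathematicalPhysics.QuantumFieldTheory.Balaban1983to89.B13Lemma3TorusTerms (terms weight)
open Literature.MathematicalPhysics.QuantumFieldTheory.Balaban1983to89.B13Lemma3TorusSocket (Lemma3Numerics)
open Literature.MathematicalPhysics.QuantumFieldTheory.Balaban1983to89.B13Bound143 (invTau)
open Literature.MathematicalPhysics.QuantumFieldTheory.Balaban1983to89.B9Thm37GlueTorus (tdist1)
open Literature.MathematicalPhysics.QuantumFieldTheory.Balaban1983to89.B5TorusCover (UT)
open Literature.MathematicalPhysics.QuantumFieldTheory.Balaban1983to89.B13PrimitiveKernels216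
  (Localisation17a Differences216 localisation17a_mono_rate)
open Literature.MathematicalPhysics.QuantumFieldTheory.Balaban1983to89.B13TermWalkData
  (WalkConsts TermKernels TermWalkData localisation17a_of_termWalkData differences216_of_termWalkData)
open Literature.MathematicalPhysics.QuantumFieldTheory.Balaban1983to89.B13TermWalkDataOneTorus (SmallTheta)
open Literature.MathematicalPhysics.QuantumFieldTheory.Balaban1983to89.Node00
open Literature.MathematicalPhysics.QuantumFieldTheory.Balaban1983to89.Node00.Sect2 (domSys domCount CPair)
open Literature.MathematicalPhysics.QuantumFieldTheory.Balaban1983to89.Node00.W1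
open Literature.Analysis.Complex.HolomorphicBanach (analyticOnNhd_of_differentiableOn)
open Summit.QuantumFields.BalabanUV.T4Continuum.Spine.NE5.TwoRunTorusPrimitiveParam (hol_and_h226_torus_of_primitives_param)
open Summit.QuantumFields.BalabanUV.T4Continuum.Spine.NE5.TwoRunTorusWalkH226 (sigma_region_glue)
open Summit.QuantumFields.YangMills.BalabanUVNodes.N18HLayerW1TermIndexed (recAdmissible_ofTerms_of_termwise)
open Summit.QuantumFields.YangMills.BalabanUVNodes.N18HLayerW1TermIndexed (stepGen_ofTerms_of_termwise hLayer_toClusterTower_ofTerms_of_termwise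
  termBound118_toClusterTower_ofTerms_of_termwise)
open Summit.QuantumFields.YangMills.BalabanUVNodes.N18HLayerW1TwoRadiiTerms (recAdmissible_ofTerms_of_termwise₂)
open Summit.QuantumFields.YangMills.BalabanUVNodes.N18HLayerW1TermWalkRecord (holAnd226_TF_of_termWalkData termwiseAn_TF_of_termWalkData)

section Located

variable (F : T4Family) (K : ℕ) {𝔸 : Type} [NormedRing 𝔸] [NormedAlgebra ℂ 𝔸] {M : ℕ} [NeZero M] (L : ℕ) [NeZero L]
  {c : B13.Consts} (𝔇 : TermData214 ({ c with κ₁ := c.κ₁ + 1 } : B13.Consts) (F.P K) 𝔸 M L) (D : Set ℂ)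
  (sp big : (j : ℕ) → (domSys (F.P K) M j).Dom → Set (CPair (F.P K) 𝔸)) {E₀ r₁ : ℝ}
  -- the located-inputs tables are OPEN (print's analyticity space with the larger radii, [II] p. 15)
  (hbigo : ∀ (k : ℕ) (Z : (domSys (F.P K) M (k + 1)).Dom), IsOpen (big (k + 1) Z))
  (hκ₁ : 1 ≤ c.κ₁) (hα₆ : c.α₆ ≠ 0)
  -- (2.18): the τ-radii on every fine torus of the catalogue; PER-DOMAIN open τ-regions at every level; the contour radii of the data
  (hpos : ∀ k : ℕ, ∀ Y : TDom (F.P K).d (L * domCount (F.P K) M (k + 1)),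
    0 < invTau c ((tsys (F.P K).d (L * domCount (F.P K) M (k + 1))).dj Y))
  (hhalf : ∀ k : ℕ, ∀ Y : TDom (F.P K).d (L * domCount (F.P K) M (k + 1)),
    invTau c ((tsys (F.P K).d (L * domCount (F.P K) M (k + 1))).dj Y) ≤ 1 / 2)
  {Uτ : (k : ℕ) → TDom (F.P K).d (L * domCount (F.P K) M (k + 1)) → Set ℂ} (hUτ : ∀ k Y, IsOpen (Uτ k Y))
  (hUtau : ∀ k : ℕ, ∀ Y : TDom (F.P K).d (L * domCount (F.P K) M (k + 1)),
    closedBall (0 : ℂ) ((invTau c ((tsys (F.P K).d (L * domCount (F.P K) M (k + 1))).dj Y))⁻¹) ⊆ Uτ k Y)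
  (hr : ∀ k : ℕ, 0 < (𝔇 k).r) (hr' : ∀ k : ℕ, (𝔇 k).r ≤ Real.exp c.κ₁ - 1)
  (hsubτ : ∀ k : ℕ, ∀ Y, ∀ x ∈ Set.uIcc (0 : ℝ) 1, closedBall (x : ℂ) (𝔇 k).r ⊆ Uτ k Y)
  -- NODE A ∕ NODE O's (v): ONE admissible small package `w`, PER TERM a walk record of the kernels at `c⁺`; the READING MAPS holomorphic into the `α`-ball
  {w : WalkConsts} {α Rσ₀ θ : ℝ} (hw : w.Admissible α Rσ₀) (hα : 0 < α) (hsm : SmallTheta w α θ)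
  (hχ0 : ∀ (k : ℕ) (Z : (domSys (F.P K) M (k + 1)).Dom) (t : TermLabel (F.P K) M k L), ∀ s ∈ D, ∀ B, 0 ≤ (𝔇 k).chiY₀ Z t s B)
  (hχc0 : ∀ (k : ℕ) (Z : (domSys (F.P K) M (k + 1)).Dom) (t : TermLabel (F.P K) M k L), ∀ s ∈ D, ∀ B, 0 ≤ (𝔇 k).chicP Z t s B)
  (hχm : ∀ (k : ℕ) (Z : (domSys (F.P K) M (k + 1)).Dom) (t : TermLabel (F.P K) M k L), ∀ s ∈ D, Measurable ((𝔇 k).chiY₀ Z t s))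
  (hχcm : ∀ (k : ℕ) (Z : (domSys (F.P K) M (k + 1)).Dom) (t : TermLabel (F.P K) M k L), ∀ s ∈ D, Measurable ((𝔇 k).chicP Z t s))
  -- NODE O: entrywise σ-holomorphy of the kernels at the configurations of the table on the open `e^{κ₁+1}`-polydisc; NODE A: symmetry ∕ `Re ≻ 0` there
  (hAhol : ∀ (k : ℕ) (Z : (domSys (F.P K) M (k + 1)).Dom), ∀ φ ∈ big (k + 1) Z, ∀ t ∈ terms L M Z,
    ∀ i j, DifferentiableOn ℂ (fun σ => (𝔇 k).A Z t φ σ i j) {σ | ∀ j, σ j ∈ ball (0 : ℂ) (Real.exp (c.κ₁ + 1))})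
  (hGhol : ∀ (k : ℕ) (Z : (domSys (F.P K) M (k + 1)).Dom), ∀ φ ∈ big (k + 1) Z, ∀ t ∈ terms L M Z,
    ∀ i j, DifferentiableOn ℂ (fun σ => ((𝔇 k).𝒦 Z t).G2 σ ((𝔇 k).uOf Z t φ) i j) {σ | ∀ j, σ j ∈ ball (0 : ℂ) (Real.exp (c.κ₁ + 1))})
  (hAs : ∀ (k : ℕ) (Z : (domSys (F.P K) M (k + 1)).Dom), ∀ φ ∈ big (k + 1) Z, ∀ t ∈ terms L M Z,
    ∀ σ : TPt (F.P K).d (domCount (F.P K) M (k + 1)) → ℂ, (∀ j, ‖σ j‖ ≤ Real.exp (c.κ₁ + 1)) → ((𝔇 k).A Z t φ σ).IsSymm)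
  (hA : ∀ (k : ℕ) (Z : (domSys (F.P K) M (k + 1)).Dom), ∀ φ ∈ big (k + 1) Z, ∀ t ∈ terms L M Z,
    ∀ σ : TPt (F.P K).d (domCount (F.P K) M (k + 1)) → ℂ, (∀ j, ‖σ j‖ ≤ Real.exp (c.κ₁ + 1)) → (((𝔇 k).A Z t φ σ).map Complex.re).PosDef)
  -- LEMMA 2 ALONG THE HISTORY ([II] (1.41), p. 15), under the (1.18) guard: potentials holomorphic IN φ on the open table, measurable, (2.20) on `Π_Y Uτ k Y`
  (hVholφ : ∀ k : ℕ, ∀ s ∈ D, ∀ old : OlderTerms (F.P K) 𝔸 M k,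
    (∀ (j : Fin (k + 1)) (Y : (domSys (F.P K) M j).Dom), ∀ ψ ∈ sp j Y,
        ‖old j Y ψ‖ ≤ E₀ * Real.exp (-(r₁ * (domSys (F.P K) M j).dj Y))) →
    (∀ (j : Fin (k + 1)) (Y : (domSys (F.P K) M j).Dom), AnalyticOnNhd ℂ (old j Y) (sp j Y)) →
    ∀ (Z : (domSys (F.P K) M (k + 1)).Dom), ∀ t ∈ terms L M Z,
      ∀ Y B, DifferentiableOn ℂ (fun φ => (𝔇 k).𝒱 Z t s old φ Y B) (big (k + 1) Z))
  (hVm : ∀ k : ℕ, ∀ s ∈ D, ∀ old : OlderTerms (F.P K) 𝔸 M k,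
    (∀ (j : Fin (k + 1)) (Y : (domSys (F.P K) M j).Dom), ∀ ψ ∈ sp j Y,
        ‖old j Y ψ‖ ≤ E₀ * Real.exp (-(r₁ * (domSys (F.P K) M j).dj Y))) →
    (∀ (j : Fin (k + 1)) (Y : (domSys (F.P K) M j).Dom), AnalyticOnNhd ℂ (old j Y) (sp j Y)) →
    ∀ (Z : (domSys (F.P K) M (k + 1)).Dom), ∀ φ ∈ big (k + 1) Z, ∀ t ∈ terms L M Z, ∀ Y, Measurable ((𝔇 k).𝒱 Z t s old φ Y))
  {γ₂ rP a₂₀ w₂₀ : ℝ} (hγ₂ : 0 ≤ γ₂) (ha0 : 0 ≤ a₂₀)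
  (qP : (k : ℕ) → (Z : (domSys (F.P K) M (k + 1)).Dom) → (t : TermLabel (F.P K) M k L) → (((𝔇 k).𝒦 Z t).Λ → ℝ) → ℝ)
  (hqP : ∀ (k : ℕ) (Z : (domSys (F.P K) M (k + 1)).Dom) (t : TermLabel (F.P K) M k L) (B : ((𝔇 k).𝒦 Z t).Λ → ℝ), qP k Z t B ≤ B ⬝ᵥ B)
  (h222 : ∀ (k : ℕ) (Z : (domSys (F.P K) M (k + 1)).Dom) (t : TermLabel (F.P K) M k L), ∀ s ∈ D, ∀ B : ((𝔇 k).𝒦 Z t).Λ → ℝ,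
    (𝔇 k).chiY₀ Z t s B * (𝔇 k).chicP Z t s B ≤ Real.exp (-(γ₂ / 2 * rP ^ 2 * (t.2.card : ℕ)) + γ₂ / 2 * qP k Z t B))
  (h220U : ∀ k : ℕ, ∀ s ∈ D, ∀ old : OlderTerms (F.P K) 𝔸 M k,
    (∀ (j : Fin (k + 1)) (Y : (domSys (F.P K) M j).Dom), ∀ ψ ∈ sp j Y,
        ‖old j Y ψ‖ ≤ E₀ * Real.exp (-(r₁ * (domSys (F.P K) M j).dj Y))) →
    (∀ (j : Fin (k + 1)) (Y : (domSys (F.P K) M j).Dom), AnalyticOnNhd ℂ (old j Y) (sp j Y)) →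
    ∀ (Z : (domSys (F.P K) M (k + 1)).Dom), ∀ φ ∈ big (k + 1) Z, ∀ t ∈ terms L M Z,
      ∀ τ : TDom (F.P K).d (L * domCount (F.P K) M (k + 1)) → ℂ, (∀ Y, τ Y ∈ Uτ k Y) →
        ∀ B : ((𝔇 k).𝒦 Z t).Λ → ℝ, ∑ Y ∈ t.1, ‖τ Y‖ * ‖(𝔇 k).𝒱 Z t s old φ Y B‖ ≤ a₂₀ / 2 * (B ⬝ᵥ B) + w₂₀)
  -- a common fibre bound for the row and column locations of every kernel record
  {m : ℕ} (hm : ∀ (k : ℕ) (Z : (domSys (F.P K) M (k + 1)).Dom) (t : TermLabel (F.P K) M k L), ((𝔇 k).𝒦 Z t).m ≤ m)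
  (hfibN : ∀ (k : ℕ) (Z : (domSys (F.P K) M (k + 1)).Dom) (t : TermLabel (F.P K) M k L) (x : UT (𝔇 k).Nf),
    (Finset.univ.filter fun j => ((𝔇 k).𝒦 Z t).locN j = x).card ≤ m)
  -- rates: the package's torus rate `w.κ`, two drops for (L16a), two more for the (2.26) chain; the record-letter numerics (T25's, per term)
  {κa κb kap' kap'' : ℝ} (hκa : κa < w.kap) (hκb : κb < κa) (h2 : kap' < κb) (h1 : kap'' < kap') (hkap'' : 0 < kap'')
  (hθR1le : ∀ (k : ℕ) (Z : (domSys (F.P K) M (k + 1)).Dom) (t : TermLabel (F.P K) M k L),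
    (m * (1 + 2 / (κb - kap')) ^ (𝔇 k).ν) * (m * (1 + 2 / (kap' - kap'')) ^ (𝔇 k).ν)
      * ((2 * w.KbarΓ * Real.exp (-(w.ε * w.Rσ)) + 2 * w.KbarΓ * α / w.R) * w.KbarC * w.KbarΓ
        + w.KbarΓ * (w.KbarC * (2 * w.KbarE * Real.exp (-(w.ε * w.Rσ)) + 2 * w.KbarE * α / w.R)
            * (((𝔇 k).𝒦 Z t).m * (1 + 2 / (w.kap - κa)) ^ (𝔇 k).ν) * w.KbarC * (((𝔇 k).𝒦 Z t).m * (1 + 2 / (κa - κb)) ^ (𝔇 k).ν))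
            * w.KbarΓ
        + w.KbarΓ * w.KbarC * (2 * w.KbarΓ * Real.exp (-(w.ε * w.Rσ)) + 2 * w.KbarΓ * α / w.R)) ≤ θ)
  (hsmallKθ : ∀ k : ℕ, w.KbarC * (m * (1 + 2 / κb) ^ (𝔇 k).ν) * (θ * (m * (1 + 2 / kap'') ^ (𝔇 k).ν)) < 1)
  {cE g : ℝ} (hc0 : 0 ≤ cE)
  (hc : ∀ (k : ℕ) (Z : (domSys (F.P K) M (k + 1)).Dom) (t : TermLabel (F.P K) M k L) (i : ((𝔇 k).𝒦 Z t).Λ),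
    ((𝔇 k).𝒦 Z t).hC.1.eigenvalues i ≤ cE)
  (hαc : ∀ k : ℕ, (2 * (θ * (m * (1 + 2 / kap'') ^ (𝔇 k).ν)) + (γ₂ + a₂₀)) * cE ≤ 1 / 2) (hg : 0 ≤ g)
  (hΓq : ∀ (k : ℕ) (Z : (domSys (F.P K) M (k + 1)).Dom) (t : TermLabel (F.P K) M k L) (X : ((𝔇 k).𝒦 Z t).Λ ⊕ ((𝔇 k).𝒦 Z t).C₀ → ℝ),
    (((𝔇 k).𝒦 Z t).Γ₀ *ᵥ X) ⬝ᵥ (((𝔇 k).𝒦 Z t).C *ᵥ (((𝔇 k).𝒦 Z t).Γ₀ *ᵥ X)) ≤ g * (X ⬝ᵥ X))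
  (hsmall : ∀ k : ℕ, (2 * (θ * (m * (1 + 2 / kap'') ^ (𝔇 k).ν)) + (γ₂ + a₂₀)) * (1 + 2 * cE * g) ≤ 1 / 2)
  {a a₅ : ℝ} (hPa : a ≤ γ₂ * rP ^ 2)
  (hvol : ∀ (k : ℕ) (Z : (domSys (F.P K) M (k + 1)).Dom) (t : TermLabel (F.P K) M k L),
    2 * (w.KbarC * (m * (1 + 2 / κb) ^ (𝔇 k).ν) * (θ * (m * (1 + 2 / kap'') ^ (𝔇 k).ν))
            * (1 + (1 - w.KbarC * (m * (1 + 2 / κb) ^ (𝔇 k).ν) * (θ * (m * (1 + 2 / kap'') ^ (𝔇 k).ν)))⁻¹) / 2)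
        * (Fintype.card ((𝔇 k).𝒦 Z t).Λ : ℝ)
      + w₂₀ + (2 * (θ * (m * (1 + 2 / kap'') ^ (𝔇 k).ν)) + (γ₂ + a₂₀)) * cE * (Fintype.card ((𝔇 k).𝒦 Z t).Λ : ℝ)
      + (2 * (θ * (m * (1 + 2 / kap'') ^ (𝔇 k).ν)) + (γ₂ + a₂₀)) * (1 + 2 * cE * g)
        * (Fintype.card (((𝔇 k).𝒦 Z t).Λ ⊕ ((𝔇 k).𝒦 Z t).C₀) : ℝ)
      ≤ a₅ * ((Z.1).card : ℝ))

include hbigo hκ₁ hα₆ hpos hhalf hUτ hUtau hr hr' hsubτ hw hα hsm hχ0 hχc0 hχm hχcm hAhol hGhol hAs hA hVholφ hVm hγ₂ ha0 hqP h222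
  h220U hm hfibN hκa hκb h2 h1 hkap'' hθR1le hsmallKθ hc0 hc hαc hg hΓq hsmall hPa hvol


/-- **(GEN) FOR THE DATUM's GENERATOR `𝔇.Gn` FROM NODE A's WALK RECORDS READ AT THE CONFIGURATION** (file 23 `stepGen_ofTerms_of_termwise`, `hTan` ∕ `hT226 :=`
file 27 §2 on `sp (k+1) Z ⊆ big (k+1) Z`): for every step, every `g ∈ D` and every older-term table in the guard class the activities `(𝔇.Gn k).H g old · Z` are
analytic at the points of `sp (k+1) Z` and (2.38)-bounded there with `A = C₃ε₁`, `R = (1−8δ)·½L·κ` — Lemma 3's resummation over print's term sum.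
[cite: Balaban1988RG2Cluster, (2.14) p.15, (2.26) p.17 and Lemma 3 (2.38) p.20, p.13; Balaban1985BackgroundPropagators, Thm 3.10 p.416] -/
theorem stepGen_Gn_of_termWalkData (h𝒦 : ∀ (k : ℕ) (Z : (domSys (F.P K) M (k + 1)).Dom), ∀ t ∈ terms L M Z, TermWalkData ((𝔇 k).𝒦 Z t) w)
    (huOf : ∀ (k : ℕ) (Z : (domSys (F.P K) M (k + 1)).Dom), ∀ t ∈ terms L M Z, DifferentiableOn ℂ ((𝔇 k).uOf Z t) (big (k + 1) Z))
    (hmaps : ∀ (k : ℕ) (Z : (domSys (F.P K) M (k + 1)).Dom), ∀ t ∈ terms L M Z,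
      MapsTo ((𝔇 k).uOf Z t) (big (k + 1) Z) (ball (0 : (𝔇 k).E₃) α))
    (hL8 : 8 ≤ c.L) (hLc : c.L = L)
    {a₂ a₂' Aabs : ℝ} (hN : Lemma3Numerics c M ((c.L : ℝ) / 2) a a₂ a₂' a₅ Aabs)
    (hbig : ∀ (k : ℕ) (Z : (domSys (F.P K) M (k + 1)).Dom), sp (k + 1) Z ⊆ big (k + 1) Z) :
    ∀ k : ℕ, ∀ s ∈ D, ∀ old : OlderTerms (F.P K) 𝔸 M k,
      (∀ (j : Fin (k + 1)) (Y : (domSys (F.P K) M j).Dom), ∀ ψ ∈ sp j Y,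
          ‖old j Y ψ‖ ≤ E₀ * Real.exp (-(r₁ * (domSys (F.P K) M j).dj Y))) →
      (∀ (j : Fin (k + 1)) (Y : (domSys (F.P K) M j).Dom), AnalyticOnNhd ℂ (old j Y) (sp j Y)) →
      (∀ Z : (domSys (F.P K) M (k + 1)).Dom, AnalyticOnNhd ℂ (fun φ => (𝔇.Gn k).H s old φ Z) (sp (k + 1) Z)) ∧
      (∀ (Z : (domSys (F.P K) M (k + 1)).Dom), ∀ φ ∈ sp (k + 1) Z,
          ‖(𝔇.Gn k).H s old φ Z‖ ≤
            c.C3act * c.ε₁ * Real.exp (-((1 - 8 * c.δ) * ((c.L : ℝ) / 2) * c.κ * (domSys (F.P K) M (k + 1)).dj Z))) :=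
  stepGen_ofTerms_of_termwise F K L 𝔇.TF D sp c hL8 hLc hN
    (termwiseAn_TF_of_termWalkData F K L 𝔇 D sp big hbigo hκ₁ hα₆ hpos hhalf hUτ hUtau hr hr' hsubτ hw hα hsm hχ0 hχc0
      hχm hχcm hAhol hGhol hAs hA hVholφ hVm hγ₂ ha0 qP hqP h222 h220U hm hfibN hκa hκb h2 h1 hkap'' hθR1le hsmallKθ hc0 hc hαc hg hΓq hsmall hPa
      hvol h𝒦 huOf hmaps sp hbig)
    (fun k s hs old hB hAn Z φ hφ t ht =>
      (holAnd226_TF_of_termWalkData F K L 𝔇 D sp big hbigo hκ₁ hα₆ hpos hhalf hUτ hUtau hr hr' hsubτ hw hα hsm hχ0 hχc0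
      hχm hχcm hAhol hGhol hAs hA hVholφ hVm hγ₂ ha0 qP hqP h222 h220U hm hfibN hκa hκb h2 h1 hkap'' hθR1le hsmallKθ hc0 hc hαc hg hΓq hsmall hPa
      hvol h𝒦 huOf hmaps k s hs old hB hAn Z t ht).2 φ (hbig k Z hφ))

/-- **THE (2.38) PAIR AT EVERY STEP OF `toClusterTower 𝔇.Gn` ON THE BOXES `]0, γ]^{k+1}` read inside `D`, FROM THE WALK RECORDS** (file 23
`hLayer_toClusterTower_ofTerms_of_termwise`) — the per-step H-layer hypotheses of files 9–13 and of dag-n18-d's junctions, at the datum, in NODE A's currency.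
[cite: Balaban1988RG2Cluster, (2.14) p.15, (2.26) p.17, Lemma 3 (2.38) p.20, p.13; Balaban1987RG1, Thm 1 p.259; Balaban1985BackgroundPropagators, Thm 3.10 p.416] -/
theorem hLayer_toClusterTower_Gn_of_termWalkData (h𝒦 : ∀ (k : ℕ) (Z : (domSys (F.P K) M (k + 1)).Dom), ∀ t ∈ terms L M Z, TermWalkData ((𝔇 k).𝒦 Z t) w)
    (huOf : ∀ (k : ℕ) (Z : (domSys (F.P K) M (k + 1)).Dom), ∀ t ∈ terms L M Z, DifferentiableOn ℂ ((𝔇 k).uOf Z t) (big (k + 1) Z))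
    (hmaps : ∀ (k : ℕ) (Z : (domSys (F.P K) M (k + 1)).Dom), ∀ t ∈ terms L M Z,
      MapsTo ((𝔇 k).uOf Z t) (big (k + 1) Z) (ball (0 : (𝔇 k).E₃) α))
    {γ : ℝ} (hrestr : ∀ k, W1.SpRestr (sp (k + 1))) (hL8 : 8 ≤ c.L) (hLc : c.L = L)
    {a₂ a₂' Aabs : ℝ} (hN : Lemma3Numerics c M ((c.L : ℝ) / 2) a a₂ a₂' a₅ Aabs)
    (hbig : ∀ (k : ℕ) (Z : (domSys (F.P K) M (k + 1)).Dom), sp (k + 1) Z ⊆ big (k + 1) Z)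
    (hr₁ : 0 ≤ r₁) (hApos : 0 ≤ c.C3act * c.ε₁) (hrate : r₁ + 2 * (64 * Real.log 162) + 2 ≤ (1 - 8 * c.δ) * ((c.L : ℝ) / 2) * c.κ)
    (hKP : c.C3act * c.ε₁ * Real.exp (5 * r₁ + 1) * K₀ 64 8 * 9 * 64 < 1)
    (hrenew : Real.exp 1 * 9 * 64 * K₀ 64 8 ^ 2 * (c.C3act * c.ε₁) ≤ E₀) (hD : ∀ s ∈ Ioc (0 : ℝ) γ, ((s : ℝ) : ℂ) ∈ D) :
    ∀ k, (toClusterTower 𝔇.Gn k).AnalyticH (box γ k) (sp (k + 1)) ∧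
      (toClusterTower 𝔇.Gn k).Bound238 (box γ k) (sp (k + 1)) (c.C3act * c.ε₁) ((1 - 8 * c.δ) * ((c.L : ℝ) / 2) * c.κ) :=
  hLayer_toClusterTower_ofTerms_of_termwise F K L 𝔇.TF D sp hrestr c hL8 hLc hN
    (termwiseAn_TF_of_termWalkData F K L 𝔇 D sp big hbigo hκ₁ hα₆ hpos hhalf hUτ hUtau hr hr' hsubτ hw hα hsm hχ0 hχc0
      hχm hχcm hAhol hGhol hAs hA hVholφ hVm hγ₂ ha0 qP hqP h222 h220U hm hfibN hκa hκb h2 h1 hkap'' hθR1le hsmallKθ hc0 hc hαc hg hΓq hsmall hPa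
      hvol h𝒦 huOf hmaps sp hbig)
    (fun k s hs old hB hAn Z φ hφ t ht =>
      (holAnd226_TF_of_termWalkData F K L 𝔇 D sp big hbigo hκ₁ hα₆ hpos hhalf hUτ hUtau hr hr' hsubτ hw hα hsm hχ0 hχc0
      hχm hχcm hAhol hGhol hAs hA hVholφ hVm hγ₂ ha0 qP hqP h222 h220U hm hfibN hκa hκb h2 h1 hkap'' hθR1le hsmallKθ hc0 hc hαc hg hΓq hsmall hPa
      hvol h𝒦 huOf hmaps k s hs old hB hAn Z t ht).2 φ (hbig k Z hφ))
    hr₁ hApos hrate hKP hrenew hD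

/-- **(1.18) FOR THE GENERATED TOWER OF THE DATUM on every history set read inside `D`, FROM THE WALK RECORDS** (file 23
`termBound118_toClusterTower_ofTerms_of_termwise`). [cite: Balaban1987RG1, (1.18) p.263 and Thm 1 p.259; Balaban1988RG2Cluster, (2.26) p.17, (2.41) p.21, p.22, p.13] -/
theorem termBound118_toClusterTower_Gn_of_termWalkData (h𝒦 : ∀ (k : ℕ) (Z : (domSys (F.P K) M (k + 1)).Dom), ∀ t ∈ terms L M Z, TermWalkData ((𝔇 k).𝒦 Z t) w)
    (huOf : ∀ (k : ℕ) (Z : (domSys (F.P K) M (k + 1)).Dom), ∀ t ∈ terms L M Z, DifferentiableOn ℂ ((𝔇 k).uOf Z t) (big (k + 1) Z))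
    (hmaps : ∀ (k : ℕ) (Z : (domSys (F.P K) M (k + 1)).Dom), ∀ t ∈ terms L M Z,
      MapsTo ((𝔇 k).uOf Z t) (big (k + 1) Z) (ball (0 : (𝔇 k).E₃) α))
    (hrestr : ∀ k, W1.SpRestr (sp (k + 1))) (hL8 : 8 ≤ c.L) (hLc : c.L = L)
    {a₂ a₂' Aabs : ℝ} (hN : Lemma3Numerics c M ((c.L : ℝ) / 2) a a₂ a₂' a₅ Aabs)
    (hbig : ∀ (k : ℕ) (Z : (domSys (F.P K) M (k + 1)).Dom), sp (k + 1) Z ⊆ big (k + 1) Z)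
    (hr₁ : 0 ≤ r₁) (hApos : 0 ≤ c.C3act * c.ε₁) (hrate : r₁ + 2 * (64 * Real.log 162) + 2 ≤ (1 - 8 * c.δ) * ((c.L : ℝ) / 2) * c.κ)
    (hKP : c.C3act * c.ε₁ * Real.exp (5 * r₁ + 1) * K₀ 64 8 * 9 * 64 < 1)
    (hrenew : Real.exp 1 * 9 * 64 * K₀ 64 8 ^ 2 * (c.C3act * c.ε₁) ≤ E₀) (W : Set (ℕ → ℝ)) (hW : ∀ g ∈ W, ∀ n, ((g n : ℝ) : ℂ) ∈ D) :
    TermBound118 (toClusterTower 𝔇.Gn) W sp E₀ r₁ :=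
  termBound118_toClusterTower_ofTerms_of_termwise F K L 𝔇.TF D sp hrestr c hL8 hLc hN
    (termwiseAn_TF_of_termWalkData F K L 𝔇 D sp big hbigo hκ₁ hα₆ hpos hhalf hUτ hUtau hr hr' hsubτ hw hα hsm hχ0 hχc0
      hχm hχcm hAhol hGhol hAs hA hVholφ hVm hγ₂ ha0 qP hqP h222 h220U hm hfibN hκa hκb h2 h1 hkap'' hθR1le hsmallKθ hc0 hc hαc hg hΓq hsmall hPa
      hvol h𝒦 huOf hmaps sp hbig)
    (fun k s hs old hB hAn Z φ hφ t ht =>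
      (holAnd226_TF_of_termWalkData F K L 𝔇 D sp big hbigo hκ₁ hα₆ hpos hhalf hUτ hUtau hr hr' hsubτ hw hα hsm hχ0 hχc0
      hχm hχcm hAhol hGhol hAs hA hVholφ hVm hγ₂ ha0 qP hqP h222 h220U hm hfibN hκa hκb h2 h1 hkap'' hθR1le hsmallKθ hc0 hc hαc hg hΓq hsmall hPa
      hvol h𝒦 huOf hmaps k s hs old hB hAn Z t ht).2 φ (hbig k Z hφ))
    hr₁ hApos hrate hKP hrenew W hW

/-- **W1's `RecAdmissible` ON `sp` FOR THE DATUM's GENERATOR ON PRINT's TABLE PAIR, FROM THE WALK RECORDS** (file 24 `recAdmissible_ofTerms_of_termwise₂`): older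
terms read on `sp`, the step's (T-an) on the LARGER table `sp′` inside the located-inputs table, the clause `Z ⊆ X ⇒ sp X ⊆ sp′ Z` ([II] p. 15: restrict through
the (i)–(iii)-space with the larger radii). [cite: Balaban1988RG2Cluster, p.15, (2.14) p.15, (2.26) p.17, p.13; Balaban1987RG1, (1.18) p.263 and Thm 1 p.259] -/
theorem recAdmissible_Gn_of_termWalkData₂ (h𝒦 : ∀ (k : ℕ) (Z : (domSys (F.P K) M (k + 1)).Dom), ∀ t ∈ terms L M Z, TermWalkData ((𝔇 k).𝒦 Z t) w)
    (huOf : ∀ (k : ℕ) (Z : (domSys (F.P K) M (k + 1)).Dom), ∀ t ∈ terms L M Z, DifferentiableOn ℂ ((𝔇 k).uOf Z t) (big (k + 1) Z))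
    (hmaps : ∀ (k : ℕ) (Z : (domSys (F.P K) M (k + 1)).Dom), ∀ t ∈ terms L M Z,
      MapsTo ((𝔇 k).uOf Z t) (big (k + 1) Z) (ball (0 : (𝔇 k).E₃) α))
    (sp' : (j : ℕ) → (domSys (F.P K) M j).Dom → Set (CPair (F.P K) 𝔸))
    (hrestr : ∀ k, ∀ X Z : (domSys (F.P K) M (k + 1)).Dom, Z.1 ⊆ X.1 → sp (k + 1) X ⊆ sp' (k + 1) Z) (hL8 : 8 ≤ c.L) (hLc : c.L = L)
    {a₂ a₂' Aabs : ℝ} (hN : Lemma3Numerics c M ((c.L : ℝ) / 2) a a₂ a₂' a₅ Aabs)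
    (hbig : ∀ (k : ℕ) (Z : (domSys (F.P K) M (k + 1)).Dom), sp' (k + 1) Z ⊆ big (k + 1) Z)
    (hr₁ : 0 ≤ r₁) (hApos : 0 ≤ c.C3act * c.ε₁) (hrate : r₁ + 2 * (64 * Real.log 162) + 2 ≤ (1 - 8 * c.δ) * ((c.L : ℝ) / 2) * c.κ)
    (hKP : c.C3act * c.ε₁ * Real.exp (5 * r₁ + 1) * K₀ 64 8 * 9 * 64 < 1)
    (hrenew : Real.exp 1 * 9 * 64 * K₀ 64 8 ^ 2 * (c.C3act * c.ε₁) ≤ E₀) :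
    RecAdmissible 𝔇.Gn D fun k => {old : OlderTerms (F.P K) 𝔸 M k |
      (∀ (j : Fin (k + 1)) (Y : (domSys (F.P K) M j).Dom), ∀ ψ ∈ sp j Y,
          ‖old j Y ψ‖ ≤ E₀ * Real.exp (-(r₁ * (domSys (F.P K) M j).dj Y))) ∧
      (∀ (j : Fin (k + 1)) (Y : (domSys (F.P K) M j).Dom), AnalyticOnNhd ℂ (old j Y) (sp j Y))} :=
  recAdmissible_ofTerms_of_termwise₂ F K L 𝔇.TF D sp sp' hrestr c hL8 hLc hN
    (termwiseAn_TF_of_termWalkData F K L 𝔇 D sp big hbigo hκ₁ hα₆ hpos hhalf hUτ hUtau hr hr' hsubτ hw hα hsm hχ0 hχc0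
      hχm hχcm hAhol hGhol hAs hA hVholφ hVm hγ₂ ha0 qP hqP h222 h220U hm hfibN hκa hκb h2 h1 hkap'' hθR1le hsmallKθ hc0 hc hαc hg hΓq hsmall hPa
      hvol h𝒦 huOf hmaps sp' hbig)
    (fun k s hs old hB hAn Z φ hφ t ht =>
      (holAnd226_TF_of_termWalkData F K L 𝔇 D sp big hbigo hκ₁ hα₆ hpos hhalf hUτ hUtau hr hr' hsubτ hw hα hsm hχ0 hχc0
      hχm hχcm hAhol hGhol hAs hA hVholφ hVm hγ₂ ha0 qP hqP h222 h220U hm hfibN hκa hκb h2 h1 hkap'' hθR1le hsmallKθ hc0 hc hαc hg hΓq hsmall hPa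
      hvol h𝒦 huOf hmaps k s hs old hB hAn Z t ht).2 φ (hbig k Z hφ))
    hr₁ hApos hrate hKP hrenew

end Located

end Summit.QuantumFields.YangMills.BalabanUVNodes.N18HLayerW1TermWalkRecordChain

end
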